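import Summits.BirchSwinnertonDyer.BirchSwinnertonDyer.Theses.Squeeze
import Summits.BirchSwinnertonDyer.BirchSwinnertonDyer.Theses.LeadingTerm
import Literature.NumberTheory.EllipticCurves.LeadingTerm
import Literature.NumberTheory.EllipticCurves.LeadingTermProofs
import Literature.NumberTheory.EllipticCurves.PAdicBSD
import Literature.NumberTheory.EllipticCurves.AnalyticRankOrderProofs
import Literature.NumberTheory.EllipticCurves.MordellWeilRankZeroProofs
import HarnessLib

/-!
# BirchSwinnertonDyer — crux `SqueezeUB` / `SqueezeUBR2` (stmt-BirchSwinnertonDyer-0145),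
# line `Sketch` (skeleton v3), stub GZK: the literature debt, itemised

Stub GZK of the three-cell cut GZK ∧ PAR ∧ UBE4 of the crux "no excess rank" is the `≤` half of
Gross–Zagier–Kolyvagin on globally minimal models,

  `∀ W, [W.IsElliptic] → [W.IsGloballyMinimal] → r_an(W) ≤ 1 → rank_ℤ W(ℚ) ≤ r_an(W)`,

a theorem in print (Gross–Zagier 1986 + Kolyvagin 1990, with modularity; Kato 2004 Cor. 14.3 at
`r_an = 0`) that the tree holds only as the undischarged named fact bsd.S17
`Literature.NumberTheory.EllipticCurves.rank_eq_analyticRank_of_analyticRank_le_one` (all in-tree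
reductions of that fact — `…_of`, `…_of_modularity`, `…_of_heegnerPoint`, … — take modularity, the
Gross–Zagier formula, Kolyvagin's Euler system and non-vanishing of quadratic twists as
hypotheses). This file does NOT prove the stub; it records, sorry-free and CONDITIONALLY, exactly
what the stub costs, in three grains:

* `squeezeUB_gzk_of_fact` (registered sub-goal): GZK ⇐ bsd.S17, three symbols (`(h W hle).1.le`).
* `squeezeUB_gzk_iff_halves`, `squeezeUB_gzk_of_rankZero_of_rankOne`: GZK is EXACTLY the
  conjunction of its two halves, (GZK0) `r_an = 0 → rank = 0` (Kolyvagin / Kato) and (GZK1)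
  `r_an = 1 → rank ≤ 1` (Gross–Zagier–Kolyvagin proper), separately pluggable.
* The halves from their primary sources, Heegner-free where possible:
  - GZK0 ⇐ Kato's finiteness theorem `kato_finite_of_L_one_ne_zero` (Astérisque 295, Cor. 14.3:
    `L(E,1) ≠ 0 ⇒ E(ℚ)` finite, no Heegner points) + the entire continuation of `L(E,s)`
    (`WeierstrassCurve.hasEntireLFunction_rat`, modularity; needed only to turn `r_an = 0` into
    `L(E,1) ≠ 0`, the proved `analyticRank_eq_zero_iff_holds`) + the proved
    `mordellWeilRank_eq_zero_of_finite` — `squeezeUB_gzk0_of_kato`;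
  - GZK1 ⇐ a Heegner field `K` with `ord_{s=1} L(E/K,s) = 1` (`hK1`) + Gross–Zagier–Kolyvagin
    over `K` (`mordellWeilRank_eq_one_of_LDerivEK_ne_zero`: `L'(E/K,1) ≠ 0 ⇒ rank E(K) = 1`),
    by `rank E(ℚ) ≤ rank E(ℚ) + rank E^{(d_K)}(ℚ) = rank E(K) = 1` (the proved
    `mordellWeilRank_add_eq_of_baseChange`) — `squeezeUB_gzk1_of_heegnerField_of_kolyvagin`; and
    `hK1` itself ⇐ parity of `r_an` + Waldspurger's non-vanishing twist + continuation
    (`squeezeUB_heegnerField_of_waldspurger`, the `r_an = 1` branch of the tree's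
    `exists_heegnerField_analyticRankEK_eq_one_of`).
  Assembled: `squeezeUB_gzk_of_kato_of_waldspurger_of_kolyvagin`. Net effect: for the `≤` HALF
  of bsd.S17 neither the rank-one Gross–Zagier formula over `ℚ` (`gross_zagier_rank_one_rat`)
  nor the Murty–Murty / Bump–Friedberg–Hoffstein simple-zero twist is needed — in the tree's
  assembly `rank_eq_analyticRank_of_analyticRank_le_one_of` the former serves the `≥` half at
  `r_an = 1` and the `≤` half at `r_an = 0` (positive rank of the twist `E^{(d_K)}`), the latter
  the Heegner field at `r_an = 0`; Kato's theorem bypasses both uses at `r_an = 0`.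
  (`squeezeUB_gzk_of_heegnerField_of_kolyvagin_of_grossZagier` keeps the link with the tree's
  own inputs.)

Everything here is glue over tree theorems; the named facts enter as hypotheses, never as
vendored statements. Nothing closes the crux or the stub.

References: Darmon, CBMS 101 (2004), Thm. 3.22 and §3.9; Kato, Astérisque 295 (2004), Cor. 14.3;
Gross, in *L-functions and Arithmetic*, LMS LNS 153 (1991), (1.1) and Thm. 1.3; Kolyvagin, *Euler
systems* (1990), Thm. A; Waldspurger, Compositio Math. 54 (1985); Silverman, AEC (2009),
Exercise 10.16.
-/

-- D-0017: single-problem summit, so `Summit.BirchSwinnertonDyer.BirchSwinnertonDyer.…` repeats a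
-- namespace BY DESIGN.
set_option linter.dupNamespace false

namespace Summit.BirchSwinnertonDyer.BirchSwinnertonDyer.Theorems

open Literature.NumberTheory.EllipticCurves WeierstrassCurve

/-! ### GZK from the packaged fact bsd.S17 -/

/-- **Stub GZK from bsd.S17** (registered sub-goal of line `Sketch`, skeleton v3). The GZK-cell
`r_an ≤ 1 → rank ≤ r_an` on globally minimal models is the `≤` half of the named fact
`rank_eq_analyticRank_of_analyticRank_le_one` (Gross–Zagier 1986 + Kolyvagin 1990 with
modularity; Darmon 2004, Thm. 3.22: `ord_{s=1} L(E,s) ≤ 1 ⇒ rank E(ℚ) = ord_{s=1} L(E,s)` and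
`Ш(E/ℚ)` finite), UNPROVED in the tree. CONDITIONAL on that fact (hypothesis).
[cite: Darmon2004, Thm. 3.22] -/
theorem squeezeUB_gzk_of_fact :
    Literature.NumberTheory.EllipticCurves.rank_eq_analyticRank_of_analyticRank_le_one →
      ∀ (W : WeierstrassCurve ℚ) [W.IsElliptic] [W.IsGloballyMinimal],
        W.analyticRank ≤ 1 → W.mordellWeilRank ≤ W.analyticRank :=
  fun h W _ _ hle => (h W hle).1.le

/-! ### GZK is exactly its two halves -/

/-- **Exactness of the split by analytic rank.** On globally minimal models, the GZK-cell
`r_an ≤ 1 → rank ≤ r_an` is EQUIVALENT to the conjunction of (GZK0) `r_an = 0 → rank = 0`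
(Kolyvagin 1990; Kato 2004, Cor. 14.3) and (GZK1) `r_an = 1 → rank ≤ 1` (Gross–Zagier 1986 +
Kolyvagin 1990). Bookkeeping in `ℕ`; unconditional. [folklore] -/
theorem squeezeUB_gzk_iff_halves :
    (∀ (W : WeierstrassCurve ℚ) [W.IsElliptic] [W.IsGloballyMinimal],
        W.analyticRank ≤ 1 → W.mordellWeilRank ≤ W.analyticRank) ↔
      ((∀ (W : WeierstrassCurve ℚ) [W.IsElliptic] [W.IsGloballyMinimal],
          W.analyticRank = 0 → W.mordellWeilRank = 0) ∧
        ∀ (W : WeierstrassCurve ℚ) [W.IsElliptic] [W.IsGloballyMinimal],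
          W.analyticRank = 1 → W.mordellWeilRank ≤ 1) := by
  constructor
  · intro h
    refine ⟨fun W _ _ h0 => ?_, fun W _ _ h1 => ?_⟩
    · have := h W (by omega)
      omega
    · have := h W (by omega)
      omega
  · rintro ⟨h0, h1⟩ W _ _ hle
    rcases Nat.le_one_iff_eq_zero_or_eq_one.mp hle with h | h
    · rw [h0 W h, h]
    · rw [h]
      exact h1 W h

/-- **GZK from its two halves stated for all elliptic `W/ℚ`** (the form in which theorems in
print are plugged: rank and analytic rank are model-independent): (GZK0) `r_an = 0 → rank = 0`
and (GZK1) `r_an = 1 → rank ≤ 1` give the GZK-cell. Unconditional implication. [folklore] -/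
theorem squeezeUB_gzk_of_rankZero_of_rankOne :
    (∀ (W : WeierstrassCurve ℚ) [W.IsElliptic], W.analyticRank = 0 → W.mordellWeilRank = 0) →
      (∀ (W : WeierstrassCurve ℚ) [W.IsElliptic], W.analyticRank = 1 → W.mordellWeilRank ≤ 1) →
        ∀ (W : WeierstrassCurve ℚ) [W.IsElliptic] [W.IsGloballyMinimal],
          W.analyticRank ≤ 1 → W.mordellWeilRank ≤ W.analyticRank :=
  fun h0 h1 => squeezeUB_gzk_iff_halves.mpr ⟨fun W _ _ h => h0 W h, fun W _ _ h => h1 W h⟩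

/-! ### The half GZK0 (`r_an = 0`) from Kato's finiteness theorem — no Heegner points -/

/-- **`r_an = 0 ⇒ rank = 0` at one curve, from Kato.** For an elliptic `W/ℚ` whose `L`-function
has an entire continuation (`hE`; modularity, Wiles / Breuil–Conrad–Diamond–Taylor 2001) and a
prime `p` at which Kato's finiteness theorem is granted (`hK : kato_finite_of_L_one_ne_zero W p`,
Kato 2004, Cor. 14.3: `L(E,1) ≠ 0 ⇒ E(ℚ)` and `Sel_{p^∞}(E/ℚ)` finite): if `ord_{s=1} L(W,s) = 0`
then `L(W,1) ≠ 0` (the proved `analyticRank_eq_zero_iff_holds`; the continuation is needed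
here — in the tree's junk branch `r_an = 0` but `L(W,1) = 0`), so `E(ℚ)` is finite and
`rank_ℤ E(ℚ) = 0` (`mordellWeilRank_eq_zero_of_finite`, a finite group is torsion).
CONDITIONAL on `hK`, `hE`. [cite: Kato2004Asterisque, Cor. 14.3 (p. 235)] -/
theorem mordellWeilRank_eq_zero_of_analyticRank_eq_zero_of_kato (W : WeierstrassCurve ℚ)
    [W.IsElliptic] (p : ℕ) [Fact p.Prime] (hK : kato_finite_of_L_one_ne_zero W p)
    (hE : W.HasEntireLFunction) (h0 : W.analyticRank = 0) : W.mordellWeilRank = 0 := by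
  have hL : W.entireLFunction 1 ≠ 0 := (W.analyticRank_eq_zero_iff_holds hE).mp h0
  haveI : Finite W.toAffine.Point := (hK hL).1
  exact WeierstrassCurve.mordellWeilRank_eq_zero_of_finite W

/-- **GZK0 from Kato + continuation** (Heegner-free discharge of the `r_an = 0` half): granting
Kato's finiteness theorem for every elliptic `E/ℚ` and prime (`hK`, Kato 2004 Cor. 14.3; used at
`p = 2` only) and the entire continuation of `L(E,s)` for every elliptic `E/ℚ` (`hE`, the named
fact `WeierstrassCurve.hasEntireLFunction_rat`, modularity), every elliptic `W/ℚ` with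
`ord_{s=1} L(W,s) = 0` has `rank_ℤ W(ℚ) = 0`. CONDITIONAL on the two named facts.
[cite: Kato2004Asterisque, Cor. 14.3 (p. 235)] -/
theorem squeezeUB_gzk0_of_kato :
    (∀ (W : WeierstrassCurve ℚ) [W.IsElliptic] (p : ℕ) [Fact p.Prime],
        kato_finite_of_L_one_ne_zero W p) →
      WeierstrassCurve.hasEntireLFunction_rat →
        ∀ (W : WeierstrassCurve ℚ) [W.IsElliptic],
          W.analyticRank = 0 → W.mordellWeilRank = 0 := by
  intro hK hE W _ h0
  haveI : Fact (2 : ℕ).Prime := ⟨Nat.prime_two⟩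
  exact mordellWeilRank_eq_zero_of_analyticRank_eq_zero_of_kato W 2 (hK W 2) (hE W) h0

/-! ### The half GZK1 (`r_an = 1`) from a Heegner field and Gross–Zagier–Kolyvagin over `K` -/

/-- **GZK1 from a Heegner field of analytic rank one and Gross–Zagier–Kolyvagin over `K`.**
Hypotheses: `hK1`, for every elliptic `W/ℚ` with `ord_{s=1} L(W,s) = 1` an imaginary quadratic
`K` satisfying the Heegner hypothesis for `N_W` with `ord_{s=1} L(W/K,s) = 1` (Darmon 2004, §3.9
(1)–(2); supplied by `squeezeUB_heegnerField_of_waldspurger`); `h₂`, Gross–Zagier + Kolyvagin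
over `K` (the named fact `mordellWeilRank_eq_one_of_LDerivEK_ne_zero`: under the Heegner
hypothesis `L'(E/K,1) ≠ 0 ⇒ rank E(K) = 1 ∧ Ш(E/K)` finite; Gross 1991, (1.1) and Thm. 1.3).
Conclusion, for globally minimal `W` with `r_an = 1`: `rank_ℤ W(ℚ) ≤ 1`. Proof:
`ord L(W/K) = 1 ⇒ L'(W/K,1) ≠ 0` unconditionally (`LDerivEK_ne_zero_of_analyticRankEK_eq_one`),
so `rank W(K) = 1` by `h₂`, and `rank W(ℚ) + rank W^{(d_K)}(ℚ) = rank W(K)`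
(`mordellWeilRank_add_eq_of_baseChange`, Silverman AEC Exercise 10.16 with Mordell–Weil). No
Gross–Zagier formula over `ℚ`, no height, no continuation enters. CONDITIONAL on `hK1`, `h₂`.
[cite: GrossLMS1991, (1.1) and Thm. 1.3] -/
theorem squeezeUB_gzk1_of_heegnerField_of_kolyvagin :
    (∀ (W : WeierstrassCurve ℚ) [W.IsElliptic], W.analyticRank = 1 →
        ∃ (K : Type) (_ : Field K) (_ : NumberField K), IsImaginaryQuadratic K ∧
          SatisfiesHeegnerHypothesis (W.conductorNorm ℤ) K ∧
            Literature.NumberTheory.EllipticCurves.analyticRankEK W K = 1) →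
      (∀ (W : WeierstrassCurve ℚ) (K : Type) [Field K] [NumberField K],
          mordellWeilRank_eq_one_of_LDerivEK_ne_zero W K) →
        ∀ (W : WeierstrassCurve ℚ) [W.IsElliptic] [W.IsGloballyMinimal],
          W.analyticRank = 1 → W.mordellWeilRank ≤ 1 := by
  intro hK1 h₂ W _ _ h1
  haveI : NeZero (W.conductorNorm ℤ) := ⟨(W.conductorNorm_pos_holds).ne'⟩
  obtain ⟨K, _, _, hKq, hH, hr⟩ := hK1 W h1
  obtain ⟨hrkK, -⟩ := h₂ W K hKq hH (LDerivEK_ne_zero_of_analyticRankEK_eq_one W K hr)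
  have hsum := W.mordellWeilRank_add_eq_of_baseChange K hKq.1 one_ne_zero hrkK
  omega

/-- **The Heegner field at analytic rank one, from parity, Waldspurger and continuation** (the
`r_an = 1` branch of the tree's `exists_heegnerField_analyticRankEK_eq_one_of`; Darmon 2004,
§3.9 (1)–(2), case `sign = -1`). If `ord_{s=1} L(W,s) = 1` then `r_an` is odd, so `w(W) = -1`
(`hpar`, the named fact `even_analyticRank_iff`: `r_an` even iff `w = +1`); Waldspurger's theorem
(`hWa`, `waldspurger_exists_heegnerField_twist_ne_zero`, Waldspurger 1985) gives an imaginary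
quadratic `K` satisfying the Heegner hypothesis for `N_W` with `L(W^{(d_K)},1) ≠ 0`, i.e.
`ord L(W^{(d_K)}) = 0`; and `ord L(W/K) = ord L(W) + ord L(W^{(d_K)}) = 1 + 0` given the
continuation (`hE`, `analyticRankEK_eq_add_of`). The Murty–Murty simple-zero twist of the
`r_an = 0` branch is NOT needed. CONDITIONAL on `hpar`, `hWa`, `hE`.
[cite: Darmon2004, §3.9, proof of Thm. 3.22, (1)–(2)] -/
theorem squeezeUB_heegnerField_of_waldspurger :
    (∀ W : WeierstrassCurve ℚ, W.even_analyticRank_iff) →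
      waldspurger_exists_heegnerField_twist_ne_zero →
        WeierstrassCurve.hasEntireLFunction_rat →
          ∀ (W : WeierstrassCurve ℚ) [W.IsElliptic], W.analyticRank = 1 →
            ∃ (K : Type) (_ : Field K) (_ : NumberField K), IsImaginaryQuadratic K ∧
              SatisfiesHeegnerHypothesis (W.conductorNorm ℤ) K ∧
                Literature.NumberTheory.EllipticCurves.analyticRankEK W K = 1 := by
  intro hpar hWa hE W _ h1
  have hw : W.rootNumber = -1 := by
    rcases W.rootNumber_eq_one_or with hw | hw
    · exact absurd ((hpar W).mpr hw) (by rw [h1]; exact Nat.not_even_one)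
    · exact hw
  obtain ⟨K, _, _, hKq, hH, hL'⟩ := hWa.exists W hw
  refine ⟨K, _, _, hKq, hH, ?_⟩
  have hd : (NumberField.discr K : ℚ) ≠ 0 := by exact_mod_cast NumberField.discr_ne_zero K
  haveI := W.isElliptic_quadraticTwist hd
  have htw : (W.quadraticTwist (NumberField.discr K : ℚ)).analyticRank = 0 := by
    -- `L(W', 1) ≠ 0` forces order of vanishing `0` (Mathlib `analyticOrderAt_eq_zero`)
    unfold WeierstrassCurve.analyticRank analyticOrderNatAt
    rw [analyticOrderAt_eq_zero.2 (Or.inr hL')]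
    rfl
  rw [analyticRankEK_eq_add_of hE, h1, htw]

/-! ### Assembly: the `≤` half of bsd.S17 from Kato, parity, Waldspurger and Kolyvagin over `K` -/

/-- **Stub GZK from its primary sources.** The GZK-cell (`r_an ≤ 1 → rank ≤ r_an` on globally
minimal models) follows from: Kato's finiteness theorem (`hK`, Kato 2004 Cor. 14.3), the entire
continuation of `L(E,s)` (`hE`, modularity), the parity of the analytic rank (`hpar`, from the
functional equation), Waldspurger's non-vanishing twist (`hWa`, Waldspurger 1985) and
Gross–Zagier + Kolyvagin over the Heegner field (`h₂`, Gross 1991 (1.1) + Thm. 1.3). By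
`squeezeUB_gzk_of_rankZero_of_rankOne` over `squeezeUB_gzk0_of_kato` (half `r_an = 0`) and
`squeezeUB_gzk1_of_heegnerField_of_kolyvagin ∘ squeezeUB_heegnerField_of_waldspurger` (half
`r_an = 1`). Compared with the tree's assembly of the full bsd.S17
(`rank_eq_analyticRank_of_analyticRank_le_one_of_hasFunctionalEquationSign`), the `≤` half needs
neither the rank-one Gross–Zagier formula over `ℚ` (`gross_zagier_rank_one_rat`) nor the
Murty–Murty simple-zero twist. CONDITIONAL on the five named inputs. [cite: Darmon2004, Thm. 3.22 and §3.9] -/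
theorem squeezeUB_gzk_of_kato_of_waldspurger_of_kolyvagin :
    (∀ (W : WeierstrassCurve ℚ) [W.IsElliptic] (p : ℕ) [Fact p.Prime],
        kato_finite_of_L_one_ne_zero W p) →
      WeierstrassCurve.hasEntireLFunction_rat →
        (∀ W : WeierstrassCurve ℚ, W.even_analyticRank_iff) →
          waldspurger_exists_heegnerField_twist_ne_zero →
            (∀ (W : WeierstrassCurve ℚ) (K : Type) [Field K] [NumberField K],
                mordellWeilRank_eq_one_of_LDerivEK_ne_zero W K) →
              ∀ (W : WeierstrassCurve ℚ) [W.IsElliptic] [W.IsGloballyMinimal],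
                W.analyticRank ≤ 1 → W.mordellWeilRank ≤ W.analyticRank := by
  intro hK hE hpar hWa h₂
  refine squeezeUB_gzk_iff_halves.mpr ⟨fun W _ _ h0 => squeezeUB_gzk0_of_kato hK hE W h0, ?_⟩
  exact squeezeUB_gzk1_of_heegnerField_of_kolyvagin
    (fun W _ h1 => squeezeUB_heegnerField_of_waldspurger hpar hWa hE W h1) h₂

/-- The same with the parity input replaced by its source, the functional equation
`Λ(E, 2-s) = w(E) Λ(E, s)` (`hFE`, the named fact `hasFunctionalEquationSign_rootNumber`;
Hecke / Atkin–Lehner via modularity), through the tree theorem `even_analyticRank_iff_of`.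
CONDITIONAL on the five named inputs. [cite: Darmon2004, Thm. 3.22 and §3.9] -/
theorem squeezeUB_gzk_of_kato_of_hasFunctionalEquationSign :
    (∀ (W : WeierstrassCurve ℚ) [W.IsElliptic] (p : ℕ) [Fact p.Prime],
        kato_finite_of_L_one_ne_zero W p) →
      WeierstrassCurve.hasEntireLFunction_rat →
        (∀ W : WeierstrassCurve ℚ, W.hasFunctionalEquationSign_rootNumber) →
          waldspurger_exists_heegnerField_twist_ne_zero →
            (∀ (W : WeierstrassCurve ℚ) (K : Type) [Field K] [NumberField K],
                mordellWeilRank_eq_one_of_LDerivEK_ne_zero W K) →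
              ∀ (W : WeierstrassCurve ℚ) [W.IsElliptic] [W.IsGloballyMinimal],
                W.analyticRank ≤ 1 → W.mordellWeilRank ≤ W.analyticRank :=
  fun hK hE hFE => squeezeUB_gzk_of_kato_of_waldspurger_of_kolyvagin hK hE
    (fun W => W.even_analyticRank_iff_of hE (hFE W))

/-- **GZK from bsd.S17's own printed inputs, `≤` half only** — sanity link with the tree: the
hypotheses of `rank_eq_analyticRank_of_analyticRank_le_one_of` (Heegner field `hK` for
`r_an ≤ 1`, Gross–Zagier–Kolyvagin over `K` `h₂`, Gross–Zagier over `ℚ` `hGZ`, continuation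
`hE`) give the full fact, hence the cell by `squeezeUB_gzk_of_fact`. CONDITIONAL.
[cite: Darmon2004, Thm. 3.22 and §3.9] -/
theorem squeezeUB_gzk_of_heegnerField_of_kolyvagin_of_grossZagier :
    (∀ (W : WeierstrassCurve ℚ) [W.IsElliptic], W.analyticRank ≤ 1 →
        ∃ (K : Type) (_ : Field K) (_ : NumberField K), IsImaginaryQuadratic K ∧
          SatisfiesHeegnerHypothesis (W.conductorNorm ℤ) K ∧
            Literature.NumberTheory.EllipticCurves.analyticRankEK W K = 1) →
      (∀ (W : WeierstrassCurve ℚ) (K : Type) [Field K] [NumberField K],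
          mordellWeilRank_eq_one_of_LDerivEK_ne_zero W K) →
        gross_zagier_rank_one_rat → WeierstrassCurve.hasEntireLFunction_rat →
          ∀ (W : WeierstrassCurve ℚ) [W.IsElliptic] [W.IsGloballyMinimal],
            W.analyticRank ≤ 1 → W.mordellWeilRank ≤ W.analyticRank :=
  fun hK h₂ hGZ hE =>
    squeezeUB_gzk_of_fact (rank_eq_analyticRank_of_analyticRank_le_one_of hK h₂ hGZ hE)

end Summit.BirchSwinnertonDyer.BirchSwinnertonDyer.Theorems
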